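import Summits.QuantumFields.YangMills.Theorems.FradkinShenkerFlowFiniteSusceptibilityWeakCouplingMirrorLogConvex
import Summits.QuantumFields.YangMills.Theorems.FradkinShenkerFlowFiniteSusceptibilityWeakCouplingAxialSusceptibility
import Summits.QuantumFields.YangMills.Theorems.FradkinShenkerFlowFiniteSusceptibilityWeakCouplingAxialSumsDecorrelation
import HarnessLib

/-!
# Lattice Vafa–Witten: a reflection-odd species has no mirror long-range order (item stmt-QuantumFields-9442)

Support file for item stmt-QuantumFields-9442 (route `FradkinShenkerFlow` of `YangMills`), crux
`Summit.QuantumFields.YangMills.Theses.FradkinShenkerFlow.FiniteSusceptibilityWeakCoupling`, line `purity-rate-split`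
(`Cruxes/FiniteSusceptibilityWeakCoupling/Lines/purity_rate_split.lean`, lead c20 reshape). STUB 0 of that line asks that,
at weak coupling, every gauge-invariant local observable `A` decorrelate from its own time-reflected image `A ∘ Θ` along the
time axis, uniformly in the odd tori. This file settles the reflection-ODD sector outright, for EVERY compact `G` and EVERY
`β ≥ 0`: if `A ∘ Θ = −A` then

* the mirror correlator is minus the axial autocorrelation, `D_A(n) = −c_A(n)`, `c_A(n) = ⟨A · τ_{n e₀} A⟩_{β,L} − ⟨A⟩²`
  (`OddSector.mirrorCorr_eq_neg_autocorr`);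
* reflection positivity makes `D_A ≥ 0`, i.e. `c_A ≤ 0`, on the lags `2R+1 ≤ n ≤ 2S−2R` (landed `MirrorLogConvex.mirrorCorr_nonneg`);
* the axial sum rule `Σ_{n<L} c_A(n) = Var(Σ_t τ_t A)/L ≥ 0` (landed `stub_axialSusceptibilityNonneg`, `…AxialSusceptibility.lean`) then bounds
  `Σ_{n<L} |c_A(n)| ≤ 2(4R+1)·sup|c_A|` UNIFORMLY in the volume (`OddSector.sum_abs_autocorr_le`): a non-positive tail cannot
  outweigh the `4R+1` uncontrolled lags;
* the monotonicity argument of `…MirrorMonotone` in its clause-free form (landed `stub_mirrorDecorrelationOfAxialSums`,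
  `…AxialSumsDecorrelation.lean`) turns the volume-uniform `ℓ¹` bound into volume-uniform decay: the registered
  `stub_oddSpeciesNoMirrorLRO`, and `oddPart_noMirrorLRO` (the odd part `A − A∘Θ` of EVERY species).

So a reflection-odd order parameter can never order against its mirror image — the lattice, positive-measure form of the
Vafa–Witten mechanism (C. Vafa, E. Witten, Phys. Rev. Lett. 53 (1984) 535) — and STUB 0 of the line lives entirely in the
reflection-EVEN sector (`…EvenReduction.lean`). No definition is introduced; nothing here is a named fact. [folklore]
-/

noncomputable section

open MeasureTheory ProbabilityTheory Finset
open Literature.MathematicalPhysics.QuantumFieldTheory hiding Site ZdEdge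
open Literature.MathematicalPhysics.QuantumLattice
open Literature.Probability.LatticeModels hiding configShift configShift_apply

namespace Summit.QuantumFields.YangMills.Theorems.FiniteSusceptibilityWeakCoupling

namespace OddSector

open MirrorDominationAxis0 MirrorLogConvex

variable {G : Type} [Group G] [TopologicalSpace G] [IsTopologicalGroup G] [CompactSpace G]
  [MeasurableSpace G] [BorelSpace G]

/-! ## §1 Odd species: the mirror correlator is minus the autocorrelation -/

/-- For a reflection-odd observable `A ∘ Θ = −A`, the mirror correlator `⟨A · τ_n(A∘Θ)⟩ − ⟨A⟩⟨A∘Θ⟩` is MINUS the axial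
autocorrelation `⟨A · τ_n A⟩ − ⟨A⟩²` (linearity of the integral; every `β`). [folklore] -/
theorem mirrorCorr_eq_neg_autocorr (r : LatticeRep G) (β : ℝ) (A : YMSpecies G)
    (hodd : ∀ V, A.F (cfgReflect V) = -A.F V) (S n : ℕ) :
    latticeConnectedCorr r.ρ β (2 * S + 1) A.F (fun V => A.F (cfgReflect V)) n =
      -latticeConnectedCorr r.ρ β (2 * S + 1) A.F A.F n := by
  unfold latticeConnectedCorr
  simp only [hodd, mul_neg, integral_neg]
  ring

/-- The swapped correlator `⟨(A∘Θ) · τ_n A⟩ − ⟨A∘Θ⟩⟨A⟩` of a reflection-odd observable is minus the autocorrelation too. [folklore] -/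
theorem swappedCorr_eq_neg_autocorr (r : LatticeRep G) (β : ℝ) (A : YMSpecies G)
    (hodd : ∀ V, A.F (cfgReflect V) = -A.F V) (S n : ℕ) :
    latticeConnectedCorr r.ρ β (2 * S + 1) (fun V => A.F (cfgReflect V)) A.F n =
      -latticeConnectedCorr r.ρ β (2 * S + 1) A.F A.F n := by
  unfold latticeConnectedCorr
  simp only [hodd, neg_mul, integral_neg]
  ring

/-! ## §2 Bounded covariances -/

/-- The axial autocorrelation of a species is bounded uniformly in the volume and the lag: `|c_A(n)| ≤ 4 a²` for a bound
`a` of `|A|` (covariance of bounded functions under a probability measure). [folklore] -/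
theorem abs_autocorr_le (r : LatticeRep G) (β : ℝ) (A : YMSpecies G) :
    ∃ B : ℝ, ∀ S n : ℕ, |latticeConnectedCorr r.ρ β (2 * S + 1) A.F A.F n| ≤ B := by
  obtain ⟨a, ha⟩ := A.bounded
  refine ⟨4 * a * a, fun S n => ?_⟩
  haveI : IsProbabilityMeasure (wilsonMeasure (d := 4) (L := 2 * S + 1) r.ρ β) :=
    isProbabilityMeasure_wilsonMeasure _ r.continuous β
  rw [← SiblingFunnel.covariance_eq_latticeConnectedCorr r β A A S n]
  exact Negative.abs_covariance_le_of_abs_le (fun U => ha _) (fun U => ha _)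

/-! ## §3 The volume-uniform `ℓ¹` bound: a non-positive tail cannot outweigh `4R+1` bounded lags -/

/-- **Elementary `ℓ¹` lemma.** If `Σ_{n<L} c(n) ≥ 0`, `c(n) ≤ 0` on the window `a ≤ n`, `n + b ≤ L − 1` and `|c| ≤ B`
everywhere, then `Σ_{n<L} |c(n)| ≤ 2 (a + b) B`: the window contributes `−Σ_window c ≤ Σ_off c ≤ (a+b) B`. [folklore] -/
theorem sum_abs_le_of_sum_nonneg_of_nonpos {c : ℕ → ℝ} {L a b : ℕ} {B : ℝ}
    (hsum : 0 ≤ ∑ n ∈ range L, c n) (hneg : ∀ n, a ≤ n → n + b + 1 ≤ L → c n ≤ 0)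
    (hB : ∀ n, |c n| ≤ B) : ∑ n ∈ range L, |c n| ≤ 2 * ((a : ℝ) + b) * B := by
  classical
  have hB0 : 0 ≤ B := (abs_nonneg _).trans (hB 0)
  set W := (range L).filter (fun n => a ≤ n ∧ n + b + 1 ≤ L) with hW
  set O := (range L).filter (fun n => ¬(a ≤ n ∧ n + b + 1 ≤ L)) with hO
  have hsplit : ∀ f : ℕ → ℝ, ∑ n ∈ range L, f n = ∑ n ∈ W, f n + ∑ n ∈ O, f n := fun f =>
    (sum_filter_add_sum_filter_not (range L) (fun n => a ≤ n ∧ n + b + 1 ≤ L) f).symm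
  -- the off-window lags: at most `a + b` of them
  have hOcard : (O.card : ℝ) ≤ a + b := by
    have h1 : O ⊆ range a ∪ Ico (L - b) L := by
      intro n hn
      rw [hO, mem_filter, mem_range] at hn
      rw [mem_union, mem_range, mem_Ico]
      omega
    have h2 : O.card ≤ a + b := by
      calc O.card ≤ (range a ∪ Ico (L - b) L).card := card_le_card h1
        _ ≤ (range a).card + (Ico (L - b) L).card := card_union_le _ _
        _ ≤ a + b := by
            rw [card_range, Nat.card_Ico]
            omega
    exact_mod_cast h2
  have hOabs : ∑ n ∈ O, |c n| ≤ ((a : ℝ) + b) * B := by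
    calc ∑ n ∈ O, |c n| ≤ ∑ _n ∈ O, B := sum_le_sum fun n _ => hB n
      _ = O.card * B := by rw [sum_const, nsmul_eq_mul]
      _ ≤ (a + b) * B := mul_le_mul_of_nonneg_right hOcard hB0
  -- on the window `|c| = -c`, and the window sum is controlled by the off-window sum
  have hWabs : ∑ n ∈ W, |c n| = -∑ n ∈ W, c n := by
    rw [← sum_neg_distrib]
    refine sum_congr rfl fun n hn => ?_
    rw [hW, mem_filter] at hn
    exact abs_of_nonpos (hneg n hn.2.1 hn.2.2)
  have hWle : -∑ n ∈ W, c n ≤ ∑ n ∈ O, |c n| := by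
    have h1 : 0 ≤ ∑ n ∈ W, c n + ∑ n ∈ O, c n := by rw [← hsplit]; exact hsum
    have h2 : ∑ n ∈ O, c n ≤ ∑ n ∈ O, |c n| := sum_le_sum fun n _ => le_abs_self _
    linarith
  rw [hsplit (fun n => |c n|), hWabs]
  linarith

/-- **The axial `ℓ¹` norm of a reflection-odd species is bounded uniformly in the volume** (every compact `G`, `β ≥ 0`),
GIVEN the axial sum rule `Σ_{n<2S+1} c_A(n) ≥ 0` on every odd torus (`hsum`, the registered `stub_axialSusceptibilityNonneg`):
with `R` a strict bound on the time coordinates of `supp A` plus one, `Σ_{n < 2S+1} |c_A^{(S)}(n)| ≤ 2(4R+1)·4a²` for all `S`.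
Reflection positivity enters through `MirrorLogConvex.mirrorCorr_nonneg` (`D_A = −c_A ≥ 0` on `[2R+1, 2S−2R]`). [folklore] -/
theorem sum_abs_autocorr_le (r : LatticeRep G) {β : ℝ} (hβ : 0 ≤ β) (A : YMSpecies G)
    (hodd : ∀ V, A.F (cfgReflect V) = -A.F V)
    (hsum : ∀ S : ℕ, 0 ≤ ∑ n ∈ range (2 * S + 1), latticeConnectedCorr r.ρ β (2 * S + 1) A.F A.F n) :
    ∃ C : ℝ, ∀ S : ℕ, ∑ n ∈ range (2 * S + 1), |latticeConnectedCorr r.ρ β (2 * S + 1) A.F A.F n| ≤ C := by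
  -- the time extent `R` of `A`
  obtain ⟨R, hRA⟩ : ∃ R : ℕ, ∀ e ∈ A.supp, (e.1 0).natAbs + 2 ≤ R := by
    refine ⟨(A.supp.sup fun e => (e.1 0).natAbs) + 2, fun e he => ?_⟩
    have := Finset.le_sup (f := fun e : ZdEdge 4 => (e.1 0).natAbs) he
    omega
  obtain ⟨B, hB⟩ := abs_autocorr_le r β A
  refine ⟨2 * (((2 * R + 1 : ℕ) : ℝ) + (2 * R : ℕ)) * B, fun S => ?_⟩
  refine sum_abs_le_of_sum_nonneg_of_nonpos (hsum S) (fun n hn hnS => ?_) (fun n => hB S n)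
  -- RP sign on the window `2R+1 ≤ n`, `n + 2R ≤ 2S`
  have h := mirrorCorr_nonneg r hβ A hRA (S := S) (m := n) hn (by omega)
  rw [mirrorCorr_eq_neg_autocorr r β A hodd] at h
  linarith

/-! ## §4 Assembly -/

/-- **Conditional core of `stub_oddSpeciesNoMirrorLRO`**: a reflection-odd species has no mirror long-range order at any
`β ≥ 0`, for every compact `G` — from the axial sum rule (`hW1`) and the clause-free monotonicity lemma (`hW2`), both landed
and discharged below; kept in this form to display exactly what the odd sector uses. [folklore] -/
theorem oddSpecies_noMirrorLRO_of (r : LatticeRep G) {β : ℝ} (hβ : 0 ≤ β) (A : YMSpecies G)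
    (hodd : ∀ V, A.F (cfgReflect V) = -A.F V)
    (hW1 : ∀ S : ℕ, 0 ≤ ∑ n ∈ range (2 * S + 1), latticeConnectedCorr r.ρ β (2 * S + 1) A.F A.F n)
    (hW2 : ∀ χ : ℝ, (∀ S : ℕ, ∑ i ∈ range (S + 1),
        |latticeConnectedCorr r.ρ β (2 * S + 1) A.F (fun V => A.F (cfgReflect V)) i| ≤ χ) →
      (∀ S : ℕ, ∑ i ∈ range (S + 1),
        |latticeConnectedCorr r.ρ β (2 * S + 1) (fun V => A.F (cfgReflect V)) A.F i| ≤ χ) →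
      ∀ ε : ℝ, 0 < ε → ∃ j₀ : ℕ, ∀ S j : ℕ, j₀ ≤ j → j ≤ S →
        |latticeConnectedCorr r.ρ β (2 * S + 1) A.F (fun V => A.F (cfgReflect V)) j| ≤ ε)
    {ε : ℝ} (hε : 0 < ε) :
    ∃ j₀ : ℕ, ∀ S j : ℕ, j₀ ≤ j → j ≤ S →
      |latticeConnectedCorr r.ρ β (2 * S + 1) A.F (fun V => A.F (cfgReflect V)) j| ≤ ε := by
  obtain ⟨C, hC⟩ := sum_abs_autocorr_le r hβ A hodd hW1
  have hhalf : ∀ S : ℕ, ∑ i ∈ range (S + 1), |latticeConnectedCorr r.ρ β (2 * S + 1) A.F A.F i| ≤ C := fun S =>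
    (sum_le_sum_of_subset_of_nonneg (range_subset_range.2 (by omega)) (fun i _ _ => abs_nonneg _)).trans (hC S)
  refine hW2 C (fun S => ?_) (fun S => ?_) ε hε
  · simpa only [mirrorCorr_eq_neg_autocorr r β A hodd, abs_neg] using hhalf S
  · simpa only [swappedCorr_eq_neg_autocorr r β A hodd, abs_neg] using hhalf S

/-- **The axial `ℓ¹` norm of a reflection-odd species is bounded uniformly in the volume** — unconditionally (every compact
`G`, every `β ≥ 0`; the sum rule is the landed `stub_axialSusceptibilityNonneg`). [folklore] -/
theorem oddSpecies_sum_abs_autocorr_le (r : LatticeRep G) {β : ℝ} (hβ : 0 ≤ β) (A : YMSpecies G)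
    (hodd : ∀ V, A.F (cfgReflect V) = -A.F V) :
    ∃ C : ℝ, ∀ S : ℕ, ∑ n ∈ range (2 * S + 1), |latticeConnectedCorr r.ρ β (2 * S + 1) A.F A.F n| ≤ C :=
  sum_abs_autocorr_le r hβ A hodd fun S => stub_axialSusceptibilityNonneg G r β A S

end OddSector

/-- **Registered sub-goal `stub_oddSpeciesNoMirrorLRO`** of item stmt-QuantumFields-9442 (signature verbatim, fully qualified) —
**lattice Vafa–Witten**: for every compact `G`, every lattice representation, every `β ≥ 0` and every reflection-ODD
gauge-invariant local observable `A ∘ Θ = −A`, the mirror correlator `⟨A · τ_{j e₀}(A∘Θ)⟩_{β,2S+1} − ⟨A⟩⟨A∘Θ⟩` tends to zero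
as `j → ∞` UNIFORMLY in the odd tori `2S+1 ≥ 2j+1` — the odd sector of STUB 0 of line `purity-rate-split` is a theorem
(no simplicity, no weak coupling). [folklore] -/
theorem stub_oddSpeciesNoMirrorLRO : ∀ (G : Type) [Group G] [TopologicalSpace G] [IsTopologicalGroup G] [CompactSpace G] [MeasurableSpace G] [BorelSpace G] (r : Literature.MathematicalPhysics.QuantumFieldTheory.LatticeRep G) (β : ℝ), 0 ≤ β → ∀ A : Literature.MathematicalPhysics.QuantumFieldTheory.YMSpecies G, (∀ V, A.F (Literature.MathematicalPhysics.QuantumFieldTheory.cfgReflect V) = -A.F V) → ∀ ε : ℝ, 0 < ε → ∃ j₀ : ℕ, ∀ S j : ℕ, j₀ ≤ j → j ≤ S → |Literature.MathematicalPhysics.QuantumFieldTheory.latticeConnectedCorr r.ρ β (2 * S + 1) A.F (fun V => A.F (Literature.MathematicalPhysics.QuantumFieldTheory.cfgReflect V)) j| ≤ ε := by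
  intro G _ _ _ _ _ _ r β hβ A hodd ε hε
  exact OddSector.oddSpecies_noMirrorLRO_of r hβ A hodd (fun S => stub_axialSusceptibilityNonneg G r β A S)
    (fun χ h₁ h₂ δ hδ => stub_mirrorDecorrelationOfAxialSums G r β hβ A χ h₁ h₂ δ hδ) hε

open MirrorDominationAxis0 in
/-- **The odd part of EVERY species has no mirror long-range order** (every compact `G`, `β ≥ 0`): if `M = A − A∘Θ` pointwise
then `M ∘ Θ = −M` (`Θ` is an involution), so `stub_oddSpeciesNoMirrorLRO` applies — half of STUB 0 for an arbitrary species,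
the other half being its even part `A + A∘Θ` (`…EvenReduction.lean`). [folklore] -/
theorem oddPart_noMirrorLRO {G : Type} [Group G] [TopologicalSpace G] [IsTopologicalGroup G] [CompactSpace G]
    [MeasurableSpace G] [BorelSpace G] (r : LatticeRep G) {β : ℝ} (hβ : 0 ≤ β) (A M : YMSpecies G)
    (hM : ∀ V, M.F V = A.F V - A.F (cfgReflect V)) {ε : ℝ} (hε : 0 < ε) :
    ∃ j₀ : ℕ, ∀ S j : ℕ, j₀ ≤ j → j ≤ S →
      |latticeConnectedCorr r.ρ β (2 * S + 1) M.F (fun V => M.F (cfgReflect V)) j| ≤ ε := by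
  have hodd : ∀ V, M.F (cfgReflect V) = -M.F V := fun V => by
    rw [hM, hM, cfgReflect_cfgReflect]; ring
  exact stub_oddSpeciesNoMirrorLRO G r β hβ M hodd ε hε

end Summit.QuantumFields.YangMills.Theorems.FiniteSusceptibilityWeakCoupling

end
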